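/-
Copyright (c) 2026 the pub-hodgecm-mathlib formalisation cell (harness21).  Prover seat hodgecm-mathlib-LH4-p10 (g6): Track A «(D-RAM) FOUR-FRAME» squad of crux H413, STAGE-1b,
(L-sq) labelled trunk — dealer LH4-plan (g13) WORD #67 (2) «(T-box | sq)», FILE 2∕2 «THE HEAD»: `SqLabelledBoxSum_holds : SqLabelledBoxSum` (LH4-p12 (g7)'s named Prop ★ p859958, BY NAME).  2026-09-04.
-/
import Literature.Uncategorized.SqLabelledBoxSum                                                 -- ★ p859958 (LH4-p12 (g7), relocated by the gate): `Literature.Uncategorized.SqLabelledBoxSum` — the statement, token for token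
import Summits.HodgeConjecture.HodgeConjecture.Theorems.F0P3cDyRamKappaCountBoxSumTruncatedTiling -- FILE 1∕2 (this seat): `window_mul_eval_trunc`, `kappa_diag_sum_brk`, `kappa_arith_trunc`; brings ★ Planes ∕ Tiling ∕ Blocks
import Summits.HodgeConjecture.HodgeConjecture.Theorems.F0P3cDyRamStableCountBoxReindex          -- ★ B10 PART 2 FILE 1 (LH4-p14 (g2)): `sum_box_eq_triple_sum`, `triple_sum_eq_diag_add_planes`, `vec3_eq_iff`
import HarnessLib

/-!
# Crux `H413`, line LH4 «(D-RAM) FOUR-FRAME» — (L-sq) labelled trunk, brick (T-box | sq) FILE 2∕2: `SqLabelledBoxSum_holds : SqLabelledBoxSum` (discharges ★ p859958)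

Cell `hodgecm-mathlib` (D-0151), FLOOR 0, crux item H413 = `stmt-HodgeConjecture-24833`, route of record `HCCMUnconditional`; squad F0∕P3c∕LH4.  ONE THEOREM (finite-sum
bookkeeping over `ℚ`; no `def`, no instance, no notation, no `sorry`, default heartbeats); lane `--supports stmt-HodgeConjecture-24833 --as helper` (count-neutral).

WHAT.  ★ p859958 `Literature.Uncategorized.SqLabelledBoxSum` (LH4-p12 (g7)'s named arithmetic Prop; the gate relocated the `def … : Prop` from the proposed
`Theorems/F0P3cDyRamSqLabelledBoxSumDefs.lean` to `Literature/Uncategorized/` and booked it as a named fact — claimed by this seat, `ledger fact claim SqLabelledBoxSum --from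
stmt-HodgeConjecture-24833`, and DISCHARGED here) is ★ p856906 `sum_box_kappa_eq_typeZero`'s STATEMENT with (i) the fence `2d ≤ nⱼ + 1` in place of
`d ≤ min nⱼ`, (ii) the glue-foot ∕ hanging conditions cut by `2ρ + (d%2 + 2d) ≤ 2·n′ + 1` (`2ρ + m* ≤ 2n′`, `n′` the plane depth), (iii) right-hand side
`SIGN·(q^{k−(d+1)∕2} − q^{k−max((d+1)∕2, B)})`.  THIS FILE proves it: `theorem SqLabelledBoxSum_holds : SqLabelledBoxSum` (the `X_holds` of the fact protocol) — the (T-asm) assembly of the labelled trunk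
`hTrunk` (LH4-p12 (g7)) takes `(hbox : SqLabelledBoxSum)` and now has it BY NAME.
PROOF = ★ p856906's proof with three local changes: the cut conjunct is folded into the glue bracket (`glue_cut_absorb`: under the foot conditions and `n′ ≡ d (2)`,
`2ρ + (d%2+2d) ≤ 2n′+1 ↔ ⌈(2ρ−n′)∕2⌉ ≤ (n′+1)∕2 − d`), so ★ `kappa_plane_sum` runs with the bracket `brk ∧ (c ≤ U(n′))` and FILE 1's `kappa_diag_sum_brk` with `d ≤ c ∧ c ≤ U(n₁)`;
the windows are evaluated by FILE 1's `window_mul_eval_trunc` (top `U`, as `U ≤ C` under the fence), the feet by ★ `foot_mul_eval` unchanged; FILE 1's `kappa_arith_trunc` closes.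
Numerics: LH4-p12 (g7) `tbox/` 4116∕4116 (cells) + `simplified.py` 6648∕6648; this seat `tbox/blocks_trunc.py` 1932∕1932 (blocks) — and the identity FAILS below the fence.
HONEST LABEL.  Count-neutral; finite-sum bookkeeping, nothing printed is asserted, no lattice enters; pays no tier-0 row (T₊ ∕ T₋ ∕ regular OPEN; `hTrunk` of ★ p859650 closes
only with LH4-p12's (T-asm)); `HC_CM` is proved only modulo the 7 printed citations (2 remaining named inputs: hLiu418 = `stmt-HodgeConjecture-24832`, h413 =
`stmt-HodgeConjecture-24833`) until rung 0 closes.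

## References
* [Kottwitz1986BaseChangeUnits] R. E. Kottwitz, *Base change for unit elements of Hecke algebras*, Compositio Math. 60 (1986), §1 pp. 240–241.
* [Rogawski1990] J. D. Rogawski, *Automorphic Representations of Unitary Groups in Three Variables*, Ann. of Math. Stud. 123 (1990), §4.9 Prop. 4.9.1 (a) p. 55, §4.10 p. 58.
-/

set_option autoImplicit false

namespace Summit.HodgeConjecture.HodgeConjecture.Cruxes.H413.F0P3cDyRamSqLabelledKappaBoxSum

open Finset
open Literature.Uncategorized (SqLabelledBoxSum)
open Summit.HodgeConjecture.HodgeConjecture.Cruxes.H413.F0P3cDyRamStableCountBoxReindex (vec3_eq_iff sum_box_eq_triple_sum triple_sum_eq_diag_add_planes)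
open Summit.HodgeConjecture.HodgeConjecture.Cruxes.H413.F0P3cDyRamKappaCountBoxSumPlanes
open Summit.HodgeConjecture.HodgeConjecture.Cruxes.H413.F0P3cDyRamKappaCountBoxSumTruncatedTiling (window_mul_eval_trunc kappa_diag_sum_brk kappa_arith_trunc)

section Absorb

variable {R : Type*} [CommRing R]

/-- Bookkeeping: a sixth conjunct of a glue-foot condition, equivalent (under the first five) to a bracket clause `E'`, moves into the bracket (the `Decidable`
instances are implicit binders so that `rw` reads them off the goal). [folklore] -/
theorem glue_cut_absorb {a1 a2 a3 a4 a5 E B : Prop} (E' : Prop) {d1 : Decidable a1} {d2 : Decidable a2} {d3 : Decidable a3} {d4 : Decidable a4} {d5 : Decidable a5}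
    {dE : Decidable E} {dB : Decidable B} [Decidable E'] (e P : R) (h : a1 → a2 → a3 → a4 → a5 → (E ↔ E')) :
    (if a1 ∧ a2 ∧ a3 ∧ a4 ∧ a5 ∧ E then (if B then e else 0) * P else 0) = (if a1 ∧ a2 ∧ a3 ∧ a4 ∧ a5 then (if B ∧ E' then e else 0) * P else 0) := by
  by_cases h5 : a1 ∧ a2 ∧ a3 ∧ a4 ∧ a5
  · obtain ⟨k1, k2, k3, k4, k5⟩ := h5
    have hiff := h k1 k2 k3 k4 k5
    have hA5 : a1 ∧ a2 ∧ a3 ∧ a4 ∧ a5 := ⟨k1, k2, k3, k4, k5⟩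
    by_cases hE : E
    · have hA6 : a1 ∧ a2 ∧ a3 ∧ a4 ∧ a5 ∧ E := ⟨k1, k2, k3, k4, k5, hE⟩
      rw [if_pos hA6, if_pos hA5]
      by_cases hB : B
      · have hBE : B ∧ E' := ⟨hB, hiff.1 hE⟩
        rw [if_pos hB, if_pos hBE]
      · have hBE : ¬ (B ∧ E') := fun h' => hB h'.1
        rw [if_neg hB, if_neg hBE]
    · have hA6 : ¬ (a1 ∧ a2 ∧ a3 ∧ a4 ∧ a5 ∧ E) := fun h' => hE h'.2.2.2.2.2
      have hBE : ¬ (B ∧ E') := fun h' => hE (hiff.2 h'.2)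
      rw [if_neg hA6, if_pos hA5, if_neg hBE, zero_mul]
  · have hA6 : ¬ (a1 ∧ a2 ∧ a3 ∧ a4 ∧ a5 ∧ E) := fun h' => h5 ⟨h'.1, h'.2.1, h'.2.2.1, h'.2.2.2.1, h'.2.2.2.2.1⟩
    rw [if_neg hA6, if_neg h5]

end Absorb

section Box

/-- **(T-box | sq) `SqLabelledBoxSum_holds : SqLabelledBoxSum`** (discharges the named fact ★ p859958) — THE TRUNCATED LABELLED κ-BOX-SUM OF THE SQUARE TRUNK holds: for every cell-value function `v` following
the κ-table of ★ p856906 with the glue feet ∕ hanging cells cut at `2ρ + m* ≤ 2n′` and every fenced isoceles key (`2d ≤ nⱼ + 1`, `nⱼ ≡ d (2)`, `2 ≤ d`, conductor side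
condition), `(q − 1)·Σ_{box} v = SIGN·(q^{k−(d+1)∕2} − q^{k−max((d+1)∕2, B)})`.  ★ p856906's proof with the cut folded into the glue bracket (`glue_cut_absorb`), FILE 1's
`kappa_diag_sum_brk` ∕ `window_mul_eval_trunc` ∕ `kappa_arith_trunc`, ★ `kappa_plane_sum` ∕ `foot_mul_eval` ∕ `sum_box_eq_triple_sum` ∕ `triple_sum_eq_diag_add_planes` unchanged.
[cite: Kottwitz1986BaseChangeUnits, §1 pp. 240–241] [cite: Rogawski1990, §4.9 Prop. 4.9.1 (a) p. 55; §4.10 p. 58] -/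
theorem SqLabelledBoxSum_holds : SqLabelledBoxSum := by
  intro q d n₁ n₂ n₃ Bx k hd hiso hfence h1 h2 h3 hBx hk i ω εH εG hω0 hω1 hω2 v hcore hT1 hT2 hT3 hG1 hG2 hG3 hH hzero
  obtain ⟨hf1, hf2, hf3⟩ := hfence
  have hd1 : 1 ≤ d := by omega
  have hdn : d ≤ min n₁ (min n₂ n₃) := le_min (by omega) (le_min (by omega) (by omega))
  -- (0) the odd-parity cells are off the shape list (★ p856906 (0) verbatim)
  have hz_diag : ∀ r, 1 ≤ r → ¬ 2 ∣ r → v ![r, r, r] = 0 := fun r hr hr2 => hzero _ (by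
    rintro (h | ⟨s', hs', -, h | h | h⟩ | ⟨ρ, s', hρ, hs', -, h | h | h⟩ | ⟨ρ, hρ, h⟩) <;> rw [vec3_eq_iff] at h <;> omega)
  have hz_p1 : ∀ r s, 1 ≤ r → ¬ 2 ∣ r → 1 ≤ s → v ![r, r + s, r + s] = 0 := fun r s hr hr2 hs => hzero _ (by
    rintro (h | ⟨s', hs', -, h | h | h⟩ | ⟨ρ, s', hρ, hs', -, h | h | h⟩ | ⟨ρ, hρ, h⟩) <;> rw [vec3_eq_iff] at h <;> omega)
  have hz_p2 : ∀ r s, 1 ≤ r → ¬ 2 ∣ r → 1 ≤ s → v ![r + s, r, r + s] = 0 := fun r s hr hr2 hs => hzero _ (by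
    rintro (h | ⟨s', hs', -, h | h | h⟩ | ⟨ρ, s', hρ, hs', -, h | h | h⟩ | ⟨ρ, hρ, h⟩) <;> rw [vec3_eq_iff] at h <;> omega)
  have hz_p3 : ∀ r s, 1 ≤ r → ¬ 2 ∣ r → 1 ≤ s → v ![r + s, r + s, r] = 0 := fun r s hr hr2 hs => hzero _ (by
    rintro (h | ⟨s', hs', -, h | h | h⟩ | ⟨ρ, s', hρ, hs', -, h | h | h⟩ | ⟨ρ, hρ, h⟩) <;> rw [vec3_eq_iff] at h <;> omega)
  have hreg : ∀ x y z : ℕ, v ![x, y, z] ≠ 0 → (x = y ∧ y = z) ∨ (y = z ∧ x < y) ∨ (x = z ∧ y < x) ∨ (x = y ∧ z < x) := by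
    intro x y z hne
    by_contra hc
    refine hne (hzero _ ?_)
    rintro (h | ⟨s', hs', hs2, h | h | h⟩ | ⟨ρ, s', hρ, hs', hs2, h | h | h⟩ | ⟨ρ, hρ, h⟩) <;> rw [vec3_eq_iff] at h <;> omega
  have hm₁ : min n₁ (min n₂ n₃) ≤ n₁ := min_le_left _ _
  have hm₂ : min n₁ (min n₂ n₃) ≤ n₂ := le_trans (min_le_right _ _) (min_le_left _ _)
  have hm₃ : min n₁ (min n₂ n₃) ≤ n₃ := le_trans (min_le_right _ _) (min_le_right _ _)
  -- (1) the planes' glued rows in the generic shape, the CUT folded into the glue bracket (`glue_cut_absorb`)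
  have hG1' : ∀ ρ s, 1 ≤ ρ → 1 ≤ s → (fun r t => v ![r, t, t]) (2 * ρ) (2 * ρ + s) =
      (if (i = 0) ∧ 2 ∣ s ∧ 2 * ρ ≤ min n₂ n₃ ∧ 2 * ρ + s ≤ n₁ then
          ω * (q : ℚ) ^ (2 * ρ + s / 2 - 1) * ((if 2 * d ≤ s then (q : ℚ) - 1 else 0) - (if s + 2 = 2 * d then 1 else 0)) else 0) +
      (if 2 ∣ s ∧ n₂ = n₃ ∧ n₁ = n₂ + s ∧ n₂ < 2 * ρ ∧ 2 * ρ - n₂ ≤ n₂ - d + 1 then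
          (if (fun s c => ((i = 0 → 2 * d ≤ s + 2 * c) ∧ (i ≠ 0 → d ≤ c)) ∧ c ≤ (n₂ + 1) / 2 - d) s ((2 * ρ - n₂ + 1) / 2) then εG 0 i else 0) *
            (q : ℚ) ^ (2 * ρ + s / 2 - (2 * ρ - n₂ + 1) / 2) else 0) := by
    intro ρ s hρ hs
    simp only []
    rw [hG1 ρ s hρ hs, (vec_single_ite _ _ i).1, (vec_bracket_ite _ _ (εG 0) i).1,
      glue_cut_absorb (E' := (2 * ρ - n₂ + 1) / 2 ≤ (n₂ + 1) / 2 - d)]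
    intro _ _ _ h4 _
    constructor <;> intro h <;> omega
  have hG2' : ∀ ρ s, 1 ≤ ρ → 1 ≤ s → (fun r t => v ![t, r, t]) (2 * ρ) (2 * ρ + s) =
      (if (i = 1) ∧ 2 ∣ s ∧ 2 * ρ ≤ min n₁ n₃ ∧ 2 * ρ + s ≤ n₂ then
          ω * (q : ℚ) ^ (2 * ρ + s / 2 - 1) * ((if 2 * d ≤ s then (q : ℚ) - 1 else 0) - (if s + 2 = 2 * d then 1 else 0)) else 0) +
      (if 2 ∣ s ∧ n₁ = n₃ ∧ n₂ = n₁ + s ∧ n₁ < 2 * ρ ∧ 2 * ρ - n₁ ≤ n₁ - d + 1 then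
          (if (fun s c => ((i = 1 → 2 * d ≤ s + 2 * c) ∧ (i ≠ 1 → d ≤ c)) ∧ c ≤ (n₁ + 1) / 2 - d) s ((2 * ρ - n₁ + 1) / 2) then εG 1 i else 0) *
            (q : ℚ) ^ (2 * ρ + s / 2 - (2 * ρ - n₁ + 1) / 2) else 0) := by
    intro ρ s hρ hs
    simp only []
    rw [hG2 ρ s hρ hs, (vec_single_ite _ _ i).2.1, (vec_bracket_ite _ _ (εG 1) i).2.1,
      glue_cut_absorb (E' := (2 * ρ - n₁ + 1) / 2 ≤ (n₁ + 1) / 2 - d)]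
    intro _ _ _ h4 _
    constructor <;> intro h <;> omega
  have hG3' : ∀ ρ s, 1 ≤ ρ → 1 ≤ s → (fun r t => v ![t, t, r]) (2 * ρ) (2 * ρ + s) =
      (if (i = 2) ∧ 2 ∣ s ∧ 2 * ρ ≤ min n₁ n₂ ∧ 2 * ρ + s ≤ n₃ then
          ω * (q : ℚ) ^ (2 * ρ + s / 2 - 1) * ((if 2 * d ≤ s then (q : ℚ) - 1 else 0) - (if s + 2 = 2 * d then 1 else 0)) else 0) +
      (if 2 ∣ s ∧ n₁ = n₂ ∧ n₃ = n₁ + s ∧ n₁ < 2 * ρ ∧ 2 * ρ - n₁ ≤ n₁ - d + 1 then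
          (if (fun s c => ((i = 2 → 2 * d ≤ s + 2 * c) ∧ (i ≠ 2 → d ≤ c)) ∧ c ≤ (n₁ + 1) / 2 - d) s ((2 * ρ - n₁ + 1) / 2) then εG 2 i else 0) *
            (q : ℚ) ^ (2 * ρ + s / 2 - (2 * ρ - n₁ + 1) / 2) else 0) := by
    intro ρ s hρ hs
    simp only []
    rw [hG3 ρ s hρ hs, (vec_single_ite _ _ i).2.2, (vec_bracket_ite _ _ (εG 2) i).2.2,
      glue_cut_absorb (E' := (2 * ρ - n₁ + 1) / 2 ≤ (n₁ + 1) / 2 - d)]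
    intro _ _ _ h4 _
    constructor <;> intro h <;> omega
  -- the hanging cells: the CUT folded into the H bracket `d ≤ c ∧ c ≤ U(n₁)`
  have hH' : ∀ ρ, 1 ≤ ρ → (fun r => v ![r, r, r]) (2 * ρ) =
      if (n₁ = n₂) ∧ (n₂ = n₃) ∧ n₁ < 2 * ρ ∧ 2 * ρ - n₁ ≤ n₁ - d + 1 ∧ (fun c => d ≤ c ∧ c ≤ (n₁ + 1) / 2 - d) ((2 * ρ - n₁ + 1) / 2)
        then εH * (q : ℚ) ^ (2 * ρ - (2 * ρ - n₁ + 1) / 2) else 0 := by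
    intro ρ hρ
    simp only []
    rw [hH ρ hρ]
    refine if_congr ?_ rfl rfl
    constructor
    · rintro ⟨k1, k2, k3, k4, k5, k6⟩; exact ⟨k1, k2, k3, k4, k5, by omega⟩
    · rintro ⟨k1, k2, k3, k4, k5, k6⟩; exact ⟨k1, k2, k3, k4, k5, by omega⟩
  -- (2) diagonal + planes, evaluated (★ re-index, FILE 1's bracketed diagonal, ★ `kappa_plane_sum` with the cut brackets)
  rw [sum_box_eq_triple_sum, triple_sum_eq_diag_add_planes Bx v hreg,
    kappa_diag_sum_brk (q : ℚ) εH (n₁ = n₂) (n₂ = n₃) (fun c => d ≤ c ∧ c ≤ (n₁ + 1) / 2 - d) (le_trans hdn hm₁) h1 (fun h12 h23 => by omega)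
      (fun r => v ![r, r, r]) hcore hH' hz_diag,
    kappa_plane_sum (q : ℚ) ω (εG 0 i) (i = 0) (fun s c => ((i = 0 → 2 * d ≤ s + 2 * c) ∧ (i ≠ 0 → d ≤ c)) ∧ c ≤ (n₂ + 1) / 2 - d) hd (le_trans hdn hm₂)
      (fun _ => h2) (by omega) (fun r t => v ![r, t, t]) hT1 hG1' hz_p1,
    kappa_plane_sum (q : ℚ) ω (εG 1 i) (i = 1) (fun s c => ((i = 1 → 2 * d ≤ s + 2 * c) ∧ (i ≠ 1 → d ≤ c)) ∧ c ≤ (n₁ + 1) / 2 - d) hd (le_trans hdn hm₁)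
      (fun _ => h1) (by omega) (fun r t => v ![t, r, t]) hT2 hG2' hz_p2,
    kappa_plane_sum (q : ℚ) ω (εG 2 i) (i = 2) (fun s c => ((i = 2 → 2 * d ≤ s + 2 * c) ∧ (i ≠ 2 → d ≤ c)) ∧ c ≤ (n₁ + 1) / 2 - d) hd (le_trans hdn hm₁)
      (fun _ => h1) (by omega) (fun r t => v ![t, t, r]) hT3 hG3' hz_p3]
  -- (3) evaluate every block times `q − 1`: feet by ★ `foot_mul_eval`, windows by FILE 1's `window_mul_eval_trunc` (top `U = (n′+1)/2 − d ≤ C` under the fence)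
  have hbrk : ∀ (p : Fin 3) (s c : ℕ), ((i = p → 2 * d ≤ s + 2 * c) ∧ (i ≠ p → d ≤ c)) ↔ (if i = p then d - s / 2 else d) ≤ c := by
    intro p s c
    by_cases hip : i = p
    · rw [if_pos hip]; constructor
      · rintro ⟨h, -⟩; have := h hip; omega
      · intro h; exact ⟨fun _ => by omega, fun h' => absurd hip h'⟩
    · rw [if_neg hip]; constructor
      · rintro ⟨-, h⟩; exact h hip
      · intro h; exact ⟨fun h' => absurd h' hip, fun _ => h⟩
  have eF0 : ((q : ℚ) - 1) * (ω * ∑ j ∈ Icc d (n₁ / 2), (q : ℚ) ^ j) + ((q : ℚ) - 1) * (ω * ∑ ρ ∈ Icc 1 (min n₂ n₃ / 2),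
      ((if ρ + d ≤ n₁ / 2 then (q : ℚ) ^ (n₁ / 2 + ρ) - (q : ℚ) ^ (2 * ρ + d - 1) else 0) - (if ρ + d ≤ n₁ / 2 + 1 then (q : ℚ) ^ (2 * ρ + d - 2) else 0)))
      = if min n₂ n₃ / 2 + d ≤ n₁ / 2 then ω * ((q : ℚ) ^ (n₁ / 2 + min n₂ n₃ / 2 + 1) - (q : ℚ) ^ (2 * (min n₂ n₃ / 2) + d)) else 0 := by
    rw [← mul_add, ← mul_add]; exact foot_mul_eval (q : ℚ) ω hd1 _ _
  have eF1 : ((q : ℚ) - 1) * (ω * ∑ j ∈ Icc d (n₂ / 2), (q : ℚ) ^ j) + ((q : ℚ) - 1) * (ω * ∑ ρ ∈ Icc 1 (min n₁ n₃ / 2),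
      ((if ρ + d ≤ n₂ / 2 then (q : ℚ) ^ (n₂ / 2 + ρ) - (q : ℚ) ^ (2 * ρ + d - 1) else 0) - (if ρ + d ≤ n₂ / 2 + 1 then (q : ℚ) ^ (2 * ρ + d - 2) else 0)))
      = if min n₁ n₃ / 2 + d ≤ n₂ / 2 then ω * ((q : ℚ) ^ (n₂ / 2 + min n₁ n₃ / 2 + 1) - (q : ℚ) ^ (2 * (min n₁ n₃ / 2) + d)) else 0 := by
    rw [← mul_add, ← mul_add]; exact foot_mul_eval (q : ℚ) ω hd1 _ _
  have eF2 : ((q : ℚ) - 1) * (ω * ∑ j ∈ Icc d (n₃ / 2), (q : ℚ) ^ j) + ((q : ℚ) - 1) * (ω * ∑ ρ ∈ Icc 1 (min n₁ n₂ / 2),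
      ((if ρ + d ≤ n₃ / 2 then (q : ℚ) ^ (n₃ / 2 + ρ) - (q : ℚ) ^ (2 * ρ + d - 1) else 0) - (if ρ + d ≤ n₃ / 2 + 1 then (q : ℚ) ^ (2 * ρ + d - 2) else 0)))
      = if min n₁ n₂ / 2 + d ≤ n₃ / 2 then ω * ((q : ℚ) ^ (n₃ / 2 + min n₁ n₂ / 2 + 1) - (q : ℚ) ^ (2 * (min n₁ n₂ / 2) + d)) else 0 := by
    rw [← mul_add, ← mul_add]; exact foot_mul_eval (q : ℚ) ω hd1 _ _
  have eD : ((q : ℚ) - 1) * (εH * ∑ c ∈ Icc 1 ((n₁ - d) / 2 + d % 2), (if d ≤ c ∧ c ≤ (n₁ + 1) / 2 - d then (q : ℚ) ^ (2 * (n₁ / 2) + c) else 0))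
      = εH * (if max 1 d ≤ (n₁ + 1) / 2 - d then (q : ℚ) ^ (2 * (n₁ / 2) + ((n₁ + 1) / 2 - d) + 1) - (q : ℚ) ^ (2 * (n₁ / 2) + max 1 d) else 0) := by
    rw [mul_left_comm, window_mul_eval_trunc (q : ℚ) _ d _ _ (by omega) (fun c => d ≤ c) (fun _ => Iff.rfl)]
  have eW0 : ((q : ℚ) - 1) * (εG 0 i * ∑ c ∈ Icc 1 ((n₂ - d) / 2 + d % 2),
        (if ((i = 0 → 2 * d ≤ n₁ - n₂ + 2 * c) ∧ (i ≠ 0 → d ≤ c)) ∧ c ≤ (n₂ + 1) / 2 - d then (q : ℚ) ^ (2 * (n₂ / 2) + (n₁ - n₂) / 2 + c) else 0))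
      = εG 0 i * (if max 1 (if i = 0 then d - (n₁ - n₂) / 2 else d) ≤ (n₂ + 1) / 2 - d then
          (q : ℚ) ^ (2 * (n₂ / 2) + (n₁ - n₂) / 2 + ((n₂ + 1) / 2 - d) + 1) - (q : ℚ) ^ (2 * (n₂ / 2) + (n₁ - n₂) / 2 + max 1 (if i = 0 then d - (n₁ - n₂) / 2 else d)) else 0) := by
    rw [mul_left_comm, window_mul_eval_trunc (q : ℚ) _ _ _ _ (by omega) _ (hbrk 0 (n₁ - n₂))]
  have eW1 : ((q : ℚ) - 1) * (εG 1 i * ∑ c ∈ Icc 1 ((n₁ - d) / 2 + d % 2),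
        (if ((i = 1 → 2 * d ≤ n₂ - n₁ + 2 * c) ∧ (i ≠ 1 → d ≤ c)) ∧ c ≤ (n₁ + 1) / 2 - d then (q : ℚ) ^ (2 * (n₁ / 2) + (n₂ - n₁) / 2 + c) else 0))
      = εG 1 i * (if max 1 (if i = 1 then d - (n₂ - n₁) / 2 else d) ≤ (n₁ + 1) / 2 - d then
          (q : ℚ) ^ (2 * (n₁ / 2) + (n₂ - n₁) / 2 + ((n₁ + 1) / 2 - d) + 1) - (q : ℚ) ^ (2 * (n₁ / 2) + (n₂ - n₁) / 2 + max 1 (if i = 1 then d - (n₂ - n₁) / 2 else d)) else 0) := by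
    rw [mul_left_comm, window_mul_eval_trunc (q : ℚ) _ _ _ _ (by omega) _ (hbrk 1 (n₂ - n₁))]
  have eW2 : ((q : ℚ) - 1) * (εG 2 i * ∑ c ∈ Icc 1 ((n₁ - d) / 2 + d % 2),
        (if ((i = 2 → 2 * d ≤ n₃ - n₁ + 2 * c) ∧ (i ≠ 2 → d ≤ c)) ∧ c ≤ (n₁ + 1) / 2 - d then (q : ℚ) ^ (2 * (n₁ / 2) + (n₃ - n₁) / 2 + c) else 0))
      = εG 2 i * (if max 1 (if i = 2 then d - (n₃ - n₁) / 2 else d) ≤ (n₁ + 1) / 2 - d then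
          (q : ℚ) ^ (2 * (n₁ / 2) + (n₃ - n₁) / 2 + ((n₁ + 1) / 2 - d) + 1) - (q : ℚ) ^ (2 * (n₁ / 2) + (n₃ - n₁) / 2 + max 1 (if i = 2 then d - (n₃ - n₁) / 2 else d)) else 0) := by
    rw [mul_left_comm, window_mul_eval_trunc (q : ℚ) _ _ _ _ (by omega) _ (hbrk 2 (n₃ - n₁))]
  simp only [mul_add, mul_ite, mul_zero]
  rw [eF0, eF1, eF2, eD, eW0, eW1, eW2]
  clear eF0 eF1 eF2 eD eW0 eW1 eW2 hG1' hG2' hG3' hH' hG1 hG2 hG3 hT1 hT2 hT3 hH hzero hreg hz_diag hz_p1 hz_p2 hz_p3 hcore hbrk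
  -- (4) FILE 1's truncated tiling
  exact kappa_arith_trunc (q : ℚ) ω εH εG hd hiso hdn h1 h2 h3 hk hf1 hf2 hf3 i hω0 hω1 hω2

end Box

end Summit.HodgeConjecture.HodgeConjecture.Cruxes.H413.F0P3cDyRamSqLabelledKappaBoxSum
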